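import Summits.QuantumFields.GaugeBoot.PlanarBootstrapLargeNRate
import HarnessLib

/-!
# The plaquette words are realised by non-backtracking closed walks: discharging the walk hypotheses of the large-`N` theorems for plaquettes (gauge-boot, large-`N` supplement 11)

HONEST FRAMING (cell `pub-gaugeboot`, page 1 of every file): the venture produces certified bounds
on lattice expectations at stated coupling, gauge group, dimension and torus size; NOT a mass gap,
NOT a continuum limit, NOT a string tension; NOT large `N` unless marked CONDITIONAL; NOT
Yang–Mills-summit-bearing (barriers `FixedCouplingUltralocality`, `PerturbativeInvisibility`).
Combinatorial bookkeeping; this file certifies no number.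

## Content

The large-`N` theorems of supplements 6 and 9 ask, for each loop word the certificate names, for a
closed walk of `ℤ^d` that is non-backtracking in Shen–Zhu–Zhu's sense and has the word's holonomy on
every configuration (so that SZZ's variance bound (1.12) applies).  Here this is DISCHARGED for the
two plaquette words of every row, `plaqWord a ν true = [a⁺, ν⁺, a⁻, ν⁻]` and
`plaqWord a ν false = [a⁺, ν⁻, a⁻, ν⁺]`, and hence for the plaquette objective itself:

* `dartHolonomy_of_eq_add` / `dartHolonomy_of_eq_sub` — a dart `y → y + e_k` carries `U(y,k)`, a dart
  `y + e_k → y` carries `U(y,k)⁻¹`;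
* ★ `walkHolonomy_plaquetteWalk` — SZZ's `plaquetteWalk x i j` has holonomy `plaquetteHolonomyZd U x i j`,
  hence `= wordHolonomyZd U x (plaqWord i j true)` (`walkHolonomy_plaquetteWalk_eq_wordHolonomyZd`);
* `plaquetteWalkNeg x i j` — the clockwise plaquette `x → x+eᵢ → x+eᵢ−eⱼ → x−eⱼ → x`; ★
  `isNonBacktrackingLoop_plaquetteWalkNeg` (`i ≠ j`); ★ `walkHolonomy_plaquetteWalkNeg_eq_wordHolonomyZd`
  (`= wordHolonomyZd U x (plaqWord i j false)`);
* ★★ `tendsto_loopImCov_plaqWord_zero_of_szz` — GIVEN SZZ (1.12), at strong 't Hooft coupling the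
  imaginary part of EVERY plaquette variable concentrates along any limit points `μ_N`:
  `Γ_{μ_N}(P̃_{a,ν,ε}, P̃_{a,ν,ε}) → 0` (`a ≠ ν`), with the rate `≤ 16/(c₀ N²)`
  (`loopImCov_plaqWord_le_of_szz`).

So in `PlanarCertificate.eventually_obj_le_suN_strongCoupling` / `obj_le_bound_add_div_sq_of_szz` the
walk hypotheses for plaquette loops (`hholP`, and `hholS`/`hholR` when those loops are plaquettes) are
met by `plaquetteWalk` / `plaquetteWalkNeg`.  [folklore]; SZZ CMP 400 (2023) §1.1 for the walk convention.
-/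

noncomputable section

open MeasureTheory Filter Topology
open scoped BigOperators
open Literature.Probability.LatticeModels (Site zdGraph zdGraph_adj_iff)
open Literature.MathematicalPhysics.QuantumLattice
open Literature.MathematicalPhysics.QuantumFieldTheory (szzThresholdSU shenZhuZhu_largeN_variance IsNonBacktrackingLoop
  plaquetteWalk isNonBacktrackingLoop_plaquetteWalk length_plaquetteWalk)
open SimpleGraph

namespace Summit.QuantumFields.GaugeBoot

variable {d N : ℕ}

/-! ## Dart holonomies by endpoints -/

section Darts

variable {G : Type*} [Group G]

/-- A dart `y → y + e_k` carries `U(y, k)`. [folklore] -/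
theorem dartHolonomy_of_eq_add (U : LGConfig d G) (e : (zdGraph d).Dart) (y : Site d) (k : Fin d)
    (h1 : e.fst = y) (h2 : e.snd = y + Pi.single k 1) : dartHolonomy U e = U (y, k) := by
  have he : e = ⟨(y, y + Pi.single k 1), zdGraph_adj_add_single y k⟩ :=
    Dart.ext _ _ (Prod.ext h1 h2)
  rw [he, dartHolonomy_add_single]

/-- A dart `y + e_k → y` carries `U(y, k)⁻¹`. [folklore] -/
theorem dartHolonomy_of_eq_sub (U : LGConfig d G) (e : (zdGraph d).Dart) (y : Site d) (k : Fin d)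
    (h1 : e.fst = y + Pi.single k 1) (h2 : e.snd = y) : dartHolonomy U e = (U (y, k))⁻¹ := by
  have he : e = (⟨(y, y + Pi.single k 1), zdGraph_adj_add_single y k⟩ : (zdGraph d).Dart).symm :=
    Dart.ext _ _ (Prod.ext h1 h2)
  rw [he, dartHolonomy_symm, dartHolonomy_add_single]

/-! ## SZZ's plaquette walk realises `plaqWord i j true` -/

/-- ★ **The holonomy of SZZ's plaquette walk is the plaquette holonomy**:
`hol(plaquetteWalk x i j) = U(x,i) U(x+eᵢ,j) U(x+eⱼ,i)⁻¹ U(x,j)⁻¹`. [folklore] -/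
theorem walkHolonomy_plaquetteWalk (U : LGConfig d G) (x : Site d) (i j : Fin d) :
    walkHolonomy U (plaquetteWalk x i j) = plaquetteHolonomyZd U x i j := by
  simp only [plaquetteWalk, walkHolonomy_cons, walkHolonomy_nil, mul_one, plaquetteHolonomyZd]
  rw [dartHolonomy_of_eq_add U _ x i rfl rfl, dartHolonomy_of_eq_add U _ (x + Pi.single i 1) j rfl rfl,
    dartHolonomy_of_eq_sub U _ (x + Pi.single j 1) i (add_right_comm _ _ _) rfl,
    dartHolonomy_of_eq_sub U _ x j rfl rfl]
  simp only [mul_assoc]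

/-- ★ Hence `plaquetteWalk x i j` realises the word `plaqWord i j true` based at `x`. [folklore] -/
theorem walkHolonomy_plaquetteWalk_eq_wordHolonomyZd (U : LGConfig d G) (x : Site d) (i j : Fin d) :
    walkHolonomy U (plaquetteWalk x i j) = wordHolonomyZd U x (plaqWord i j true) := by
  rw [walkHolonomy_plaquetteWalk, plaqWord_true, wordHolonomyZd_plaquette]

/-! ## The clockwise plaquette walk realises `plaqWord i j false` -/

/-- **The clockwise plaquette** `x → x + eᵢ → x + eᵢ − eⱼ → x − eⱼ → x` as a closed walk of `ℤ^d`
(the boundary of the square below the link `(x, i)` in the `(i, j)` plane). [folklore] -/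
def plaquetteWalkNeg (x : Site d) (i j : Fin d) : (zdGraph d).Walk x x :=
  Walk.cons (zdGraph_adj_add_single x i) <|
    Walk.cons (show (zdGraph d).Adj (x + Pi.single i 1) (x + Pi.single i 1 - Pi.single j 1) by
        have h := (zdGraph_adj_add_single (x + Pi.single i 1 - Pi.single j 1) j).symm
        rwa [sub_add_cancel] at h) <|
      Walk.cons (show (zdGraph d).Adj (x + Pi.single i 1 - Pi.single j 1) (x - Pi.single j 1) by
          have h := (zdGraph_adj_add_single (x - Pi.single j 1) i).symm
          rwa [sub_add_eq_add_sub] at h) <|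
        Walk.cons (show (zdGraph d).Adj (x - Pi.single j 1) x by
            have h := zdGraph_adj_add_single (x - Pi.single j 1) j
            rwa [sub_add_cancel] at h) Walk.nil

/-- The clockwise plaquette has four edges. [folklore] -/
@[simp] theorem length_plaquetteWalkNeg (x : Site d) (i j : Fin d) : (plaquetteWalkNeg x i j).length = 4 := by
  simp [plaquetteWalkNeg]

/-- ★ **Its holonomy is that of `plaqWord i j false`**: `U(x,i) U(x+eᵢ−eⱼ,j)⁻¹ U(x−eⱼ,i)⁻¹ U(x−eⱼ,j)`.
[folklore] -/
theorem walkHolonomy_plaquetteWalkNeg_eq_wordHolonomyZd (U : LGConfig d G) (x : Site d) (i j : Fin d) :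
    walkHolonomy U (plaquetteWalkNeg x i j) = wordHolonomyZd U x (plaqWord i j false) := by
  simp only [plaquetteWalkNeg, walkHolonomy_cons, walkHolonomy_nil, mul_one]
  rw [dartHolonomy_of_eq_add U _ x i rfl rfl,
    dartHolonomy_of_eq_sub U _ (x + Pi.single i 1 - Pi.single j 1) j (sub_add_cancel _ _).symm rfl,
    dartHolonomy_of_eq_sub U _ (x - Pi.single j 1) i (sub_add_eq_add_sub _ _ _).symm rfl,
    dartHolonomy_of_eq_add U _ (x - Pi.single j 1) j rfl (sub_add_cancel _ _).symm]
  have h1 : x + Pi.single i 1 - Pi.single j 1 - Pi.single i (1 : ℤ) = x - Pi.single j 1 := by abel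
  simp only [plaqWord_false, wordHolonomyZd_cons, wordHolonomyZd_nil, stepHolonomyZd_fwd, stepHolonomyZd_bwd, Step.applyZd_fwd,
    Step.applyZd_bwd, h1, mul_one]

/-- `eᵢ ≠ eⱼ` for `i ≠ j`. [folklore] -/
private theorem single_ne_single {i j : Fin d} (hij : i ≠ j) :
    (Pi.single i (1 : ℤ) : Site d) ≠ Pi.single j 1 := by
  intro h
  have := congr_fun h i
  simp [Pi.single_eq_of_ne hij] at this

/-- `eᵢ + eⱼ ≠ 0`. [folklore] -/
private theorem single_add_single_ne_zero (i j : Fin d) :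
    (Pi.single i (1 : ℤ) : Site d) + Pi.single j 1 ≠ 0 := by
  intro h
  have := congr_fun h i
  simp only [Pi.add_apply, Pi.single_eq_same, Pi.zero_apply] at this
  by_cases hij : j = i
  · subst hij; simp at this
  · rw [Pi.single_eq_of_ne (Ne.symm hij)] at this; omega

/-- ★ **The clockwise plaquette is a loop in SZZ's sense** (non-backtracking, read cyclically) for
`i ≠ j`. [folklore] -/
theorem isNonBacktrackingLoop_plaquetteWalkNeg (x : Site d) {i j : Fin d} (hij : i ≠ j) :
    IsNonBacktrackingLoop (plaquetteWalkNeg x i j) := by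
  refine ⟨by simp [plaquetteWalkNeg], ?_⟩
  -- the four "no immediate reversal" facts, as inequalities of sites
  have hA : x + Pi.single i 1 - Pi.single j (1 : ℤ) ≠ x := by
    intro h
    apply single_ne_single hij
    have : (Pi.single i (1 : ℤ) : Site d) - Pi.single j 1 = 0 := by
      have := congrArg (· - x) h; simpa [add_sub_assoc, add_sub_cancel_left] using this
    exact sub_eq_zero.1 this
  have hB : x - Pi.single j (1 : ℤ) ≠ x + Pi.single i 1 := by
    intro h
    apply single_add_single_ne_zero i j
    have := congrArg (· - x + Pi.single j 1) h
    simp only [sub_sub_cancel_left, neg_add_cancel, add_sub_cancel_left] at this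
    rw [eq_comm] at this; exact this
  simp only [plaquetteWalkNeg, Walk.darts_cons, Walk.darts_nil, List.take, List.cons_append, List.nil_append,
    List.isChain_cons_cons, List.isChain_singleton, and_true, ne_eq, Dart.ext_iff, Dart.symm_toProd, Prod.swap_prod_mk,
    Prod.mk.injEq, true_and]
  refine ⟨?_, ?_, ?_, ?_⟩
  all_goals first | exact hA | exact hB | exact fun h => hA h.symm | exact fun h => hB h.symm

end Darts

/-! ## Consequence: the plaquette variables concentrate (given SZZ) -/

/-- ★★ **The imaginary part of every plaquette variable concentrates at strong 't Hooft coupling**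
(given SZZ (1.12)): for `d ≥ 2`, `|βt| < 1/(16(d−1))`, `a ≠ ν`, thermodynamic limit points `μ_N` of
the `SU(N)` torus states at tree coupling `N·βt`: `Γ_{μ_N}(P̃_{a,ν,ε}, P̃_{a,ν,ε}) → 0`, both
orientations `ε`. [cite: ShenZhuZhuCMP2023, Corollary 1.5] -/
theorem tendsto_loopImCov_plaqWord_zero_of_szz (hfact : ∀ N, shenZhuZhu_largeN_variance d N) (hd : 2 ≤ d)
    {βt : ℝ} (hβ : |βt| < szzThresholdSU d)
    (μ : (N : ℕ) → Measure (LGConfig d (Matrix.specialUnitaryGroup (Fin N) ℂ)))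
    (hμ : ∀ N, 1 ≤ N → μ N ∈ infiniteVolumeLimitPoints (d := d) (fundamentalRep (Fin N)) ((N : ℝ) * βt))
    (x : Site d) {a ν : Fin d} (haν : a ≠ ν) (ε : Bool) :
    Tendsto (fun N => loopImCov (fundamentalRep (Fin N)) (μ N) x (plaqWord a ν ε) (plaqWord a ν ε)) atTop (𝓝 0) := by
  cases ε with
  | true =>
    exact tendsto_loopImCov_zero_of_szz hfact hd hβ μ hμ x _ (plaquetteWalk x a ν) (isNonBacktrackingLoop_plaquetteWalk x haν)
      fun N U => walkHolonomy_plaquetteWalk_eq_wordHolonomyZd U x a ν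
  | false =>
    exact tendsto_loopImCov_zero_of_szz hfact hd hβ μ hμ x _ (plaquetteWalkNeg x a ν)
      (isNonBacktrackingLoop_plaquetteWalkNeg x haν) fun N U => walkHolonomy_plaquetteWalkNeg_eq_wordHolonomyZd U x a ν

/-- ★ **The rate for plaquettes**: `Γ_{μ_N}(P̃, P̃) ≤ 16/(c₀ N²)` (`n(n−3) = 4` for a plaquette),
given SZZ (1.12). [cite: ShenZhuZhuCMP2023, Corollary 1.5] -/
theorem loopImCov_plaqWord_le_of_szz (hfact : ∀ N, shenZhuZhu_largeN_variance d N) (hd : 2 ≤ d) {βt : ℝ}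
    (hβ : |βt| < szzThresholdSU d) (hN : 1 ≤ N) {μ : Measure (LGConfig d (Matrix.specialUnitaryGroup (Fin N) ℂ))}
    (hμ : μ ∈ infiniteVolumeLimitPoints (d := d) (fundamentalRep (Fin N)) ((N : ℝ) * βt))
    (x : Site d) {a ν : Fin d} (haν : a ≠ ν) (ε : Bool) :
    loopImCov (fundamentalRep (Fin N)) μ x (plaqWord a ν ε) (plaqWord a ν ε) ≤ 16 / szzPlanarSlope d βt / (N : ℝ) ^ 2 := by
  have h16 : (4 : ℝ) * ((4 : ℕ) * (((4 : ℕ) : ℝ) - 3)) = 16 := by norm_num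
  cases ε with
  | true =>
    have h := loopImCov_le_of_szz hfact hd hβ hN hμ x _ (plaquetteWalk x a ν) (isNonBacktrackingLoop_plaquetteWalk x haν)
      fun U => walkHolonomy_plaquetteWalk_eq_wordHolonomyZd U x a ν
    rwa [length_plaquetteWalk, h16] at h
  | false =>
    have h := loopImCov_le_of_szz hfact hd hβ hN hμ x _ (plaquetteWalkNeg x a ν) (isNonBacktrackingLoop_plaquetteWalkNeg x haν)
      fun U => walkHolonomy_plaquetteWalkNeg_eq_wordHolonomyZd U x a ν
    rwa [length_plaquetteWalkNeg, h16] at h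

end Summit.QuantumFields.GaugeBoot

end
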